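import Mathlib.Topology.Homotopy.Equiv
import Mathlib.Topology.Homotopy.Contractible
import Mathlib.Analysis.Normed.Module.FiniteDimension
import HarnessLib

/-!
# The complement of an embedded open ball is homotopy equivalent to the complement of its centre

Topic `Literature/AlgebraicTopology/Homotopy`. Elementary homotopy theory absent from Mathlib: for
an open embedding `i : E → X` of a finite-dimensional (proper) real normed space into a Hausdorff
space — e.g. a chart / "open disc" of a manifold — the inclusion
`X ∖ i(B̊(0, 1)) ↪ X ∖ {i 0}` of the complement of the image of the open unit ball into the
complement of the centre is a homotopy equivalence; indeed `X ∖ i(B̊)` is a strong deformation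
retract of `X ∖ {i 0}`, by pushing the punctured ball radially onto the unit sphere inside the
chart and keeping everything else fixed (`Literature.AlgebraicTopology.Homotopy.ComplBall.homotopyEquiv`,
`Literature.AlgebraicTopology.Homotopy.ComplBall.contractibleSpace_iff`). This is the identification "`M - Interior i(½Dⁿ)` ≃
`M ∖ {pt}`" used silently in Kervaire–Milnor, *Groups of homotopy spheres I* (1963), proofs of
Lemmas 2.2 and 2.4 (pp. 506–507), and in every excision / Seifert–van Kampen argument about
punctured manifolds (Hatcher, *Algebraic Topology* (2002), Ch. 0: deformation retractions,
p. 2; Exercise 2, p. 18: "Construct an explicit deformation retraction of `ℝⁿ - {0}` onto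
`Sⁿ⁻¹`").

## Construction

With `φ = i⁻¹` on `range i` (`IsOpenEmbedding.toOpenPartialHomeomorph`), the radial push
`rₛ(u) = (s + (1 - s) · max(‖u‖, 1)/‖u‖) • u` of `E ∖ {0}` (`r₁ = id`, `r₀` retracts the punctured
unit ball onto the unit sphere, `rₛ = id` where `‖u‖ ≥ 1`) is transported to
`pushMap s x = i (rₛ (φ x))` on `range i` and `pushMap s x = x` elsewhere. Continuity on
`ℝ × (X ∖ {i 0})` is checked on the open cover by `range i ∖ {i 0}` and `X ∖ i(B̄(0, 1))` (the
latter is open because the closed unit ball is compact — this is where finite dimension, in the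
form `ProperSpace E`, and `T2Space X` are used), on which `pushMap` is respectively
`i ∘ rₛ ∘ φ` and the identity.

## References

* A. Hatcher, *Algebraic Topology*, CUP (2002), Ch. 0 (deformation retractions, p. 2; Exercise 2,
  p. 18). [HatcherAT2002]
* M. Kervaire, J. Milnor, *Groups of homotopy spheres I*, Ann. of Math. 77 (1963), §2,
  pp. 506–507. [KervaireMilnorAnnals1963]
-/

open Set Function Topology Metric
open scoped unitInterval Topology ContinuousMap

noncomputable section

namespace Literature.AlgebraicTopology.Homotopy

namespace ComplBall

variable {E : Type*} [NormedAddCommGroup E] [NormedSpace ℝ E]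

/-! ### The radial push in the normed space -/

/-- The coefficient `s + (1 - s) · max(‖u‖, 1)/‖u‖` of the radial push. [folklore] -/
def radialCoeff (s : ℝ) (u : E) : ℝ := s + (1 - s) * (max ‖u‖ 1 / ‖u‖)

/-- **The radial push** `rₛ(u) = (s + (1 - s) · max(‖u‖, 1)/‖u‖) • u` of `E ∖ {0}`: `r₁ = id`,
`r₀` pushes the punctured open unit ball onto the unit sphere, and `rₛ(u) = u` whenever
`‖u‖ ≥ 1` (Hatcher, *Algebraic Topology*, Ch. 0, Exercise 2, p. 18, done inside a chart). [folklore] -/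
def radialPush (s : ℝ) (u : E) : E := radialCoeff s u • u

/-- At time `1` the radial push is the identity. [folklore] -/
@[simp] theorem radialPush_one (u : E) : radialPush 1 u = u := by
  simp [radialPush, radialCoeff]

/-- The radial push fixes every vector of norm `≥ 1`. [folklore] -/
theorem radialPush_of_one_le (s : ℝ) {u : E} (hu : 1 ≤ ‖u‖) : radialPush s u = u := by
  have h0 : ‖u‖ ≠ 0 := by linarith
  simp [radialPush, radialCoeff, max_eq_left hu, div_self h0]

omit [NormedSpace ℝ E] in
/-- For `u ≠ 0` and `s ∈ [0, 1]` the coefficient of the radial push is at least `1`. [folklore] -/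
theorem one_le_radialCoeff {s : ℝ} (hs : s ∈ Icc (0 : ℝ) 1) {u : E} (hu : u ≠ 0) :
    1 ≤ radialCoeff s u := by
  have hn : 0 < ‖u‖ := norm_pos_iff.2 hu
  have h1 : 1 ≤ max ‖u‖ 1 / ‖u‖ := by
    rw [le_div_iff₀ hn, one_mul]; exact le_max_left _ _
  have : radialCoeff s u = 1 + (1 - s) * (max ‖u‖ 1 / ‖u‖ - 1) := by
    simp only [radialCoeff]; ring
  rw [this]
  nlinarith [hs.2, h1]

/-- For `u ≠ 0` and `s ∈ [0, 1]` the radial push does not vanish. [folklore] -/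
theorem radialPush_ne_zero {s : ℝ} (hs : s ∈ Icc (0 : ℝ) 1) {u : E} (hu : u ≠ 0) :
    radialPush s u ≠ 0 := by
  rw [radialPush, smul_ne_zero_iff]
  exact ⟨by linarith [one_le_radialCoeff hs hu], hu⟩

/-- At time `0` the radial push lands outside the open unit ball. [folklore] -/
theorem one_le_norm_radialPush_zero {u : E} (hu : u ≠ 0) : 1 ≤ ‖radialPush 0 u‖ := by
  have hn : 0 < ‖u‖ := norm_pos_iff.2 hu
  have : radialPush 0 u = (max ‖u‖ 1 / ‖u‖) • u := by simp [radialPush, radialCoeff]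
  rw [this, norm_smul, Real.norm_eq_abs, abs_of_nonneg (div_nonneg (by positivity) hn.le),
    div_mul_cancel₀ _ hn.ne']
  exact le_max_right _ _

/-- The radial push is continuous on `ℝ × (E ∖ {0})`. [folklore] -/
theorem continuousOn_radialPush :
    ContinuousOn (fun p : ℝ × E => radialPush p.1 p.2) {p | p.2 ≠ 0} := by
  refine ContinuousOn.smul ?_ continuousOn_snd
  refine continuousOn_fst.add ((continuousOn_const.sub continuousOn_fst).mul ?_)
  refine ContinuousOn.div ((continuous_norm.comp continuous_snd).max continuous_const).continuousOn
    (continuous_norm.comp continuous_snd).continuousOn fun p hp => ?_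
  exact norm_ne_zero_iff.2 hp

/-! ### The push transported into `X` along an open embedding -/

variable {X : Type*} [TopologicalSpace X] {i : E → X}

open Classical in
/-- **The radial push transported along the open embedding `i`**: `i ∘ rₛ ∘ i⁻¹` on `range i` and
the identity elsewhere (the value at the centre `i 0` is junk). [folklore] -/
def pushMap (hi : IsOpenEmbedding i) (s : ℝ) (x : X) : X :=
  if x ∈ range i then i (radialPush s ((hi.toOpenPartialHomeomorph i).symm x)) else x

/-- Off `range i` the push is the identity. [folklore] -/
theorem pushMap_of_not_mem (hi : IsOpenEmbedding i) (s : ℝ) {x : X} (hx : x ∉ range i) :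
    pushMap hi s x = x := by
  simp [pushMap, hx]

/-- On `range i` the push is `i ∘ rₛ ∘ i⁻¹`: `pushMap s (i u) = i (rₛ u)`. [folklore] -/
theorem pushMap_apply (hi : IsOpenEmbedding i) (s : ℝ) (u : E) :
    pushMap hi s (i u) = i (radialPush s u) := by
  simp only [pushMap, mem_range_self, ↓reduceIte]
  rw [hi.toOpenPartialHomeomorph_left_inv]

/-- The push fixes every point outside the image of the open unit ball. [folklore] -/
theorem pushMap_eq_self (hi : IsOpenEmbedding i) (s : ℝ) {x : X} (hx : x ∉ i '' ball (0 : E) 1) :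
    pushMap hi s x = x := by
  by_cases h : x ∈ range i
  · obtain ⟨u, rfl⟩ := h
    rw [pushMap_apply, radialPush_of_one_le]
    by_contra h'
    exact hx ⟨u, by simpa using h', rfl⟩
  · exact pushMap_of_not_mem hi s h

/-- At time `1` the push is the identity. [folklore] -/
@[simp] theorem pushMap_one (hi : IsOpenEmbedding i) (x : X) : pushMap hi 1 x = x := by
  by_cases h : x ∈ range i
  · obtain ⟨u, rfl⟩ := h
    rw [pushMap_apply, radialPush_one]
  · exact pushMap_of_not_mem hi 1 h

/-- For `s ∈ [0, 1]` the push never hits the centre `i 0` (off the centre). [folklore] -/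
theorem pushMap_ne_center (hi : IsOpenEmbedding i) {s : ℝ} (hs : s ∈ Icc (0 : ℝ) 1) {x : X}
    (hx : x ≠ i 0) : pushMap hi s x ≠ i 0 := by
  by_cases h : x ∈ range i
  · obtain ⟨u, rfl⟩ := h
    have hu : u ≠ 0 := fun h => hx (by rw [h])
    rw [pushMap_apply]
    exact fun h' => radialPush_ne_zero hs hu (hi.injective h')
  · rwa [pushMap_of_not_mem hi s h]

/-- At time `0` the push lands outside the image of the open unit ball (off the centre).
[folklore] -/
theorem pushMap_zero_not_mem (hi : IsOpenEmbedding i) {x : X} (hx : x ≠ i 0) :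
    pushMap hi 0 x ∉ i '' ball (0 : E) 1 := by
  by_cases h : x ∈ range i
  · obtain ⟨u, rfl⟩ := h
    have hu : u ≠ 0 := fun h => hx (by rw [h])
    rw [pushMap_apply]
    rintro ⟨v, hv, hv'⟩
    rw [hi.injective hv'] at hv
    have := one_le_norm_radialPush_zero hu
    rw [mem_ball_zero_iff] at hv
    linarith
  · rw [pushMap_of_not_mem hi 0 h]
    exact fun ⟨v, _, hv⟩ => h ⟨v, hv⟩

variable [T2Space X] [ProperSpace E]

omit [NormedSpace ℝ E] in
/-- The image of the closed unit ball under the open embedding is closed (it is compact, the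
space being proper and `X` Hausdorff). [folklore] -/
theorem isClosed_image_closedBall (hi : IsOpenEmbedding i) : IsClosed (i '' closedBall (0 : E) 1) :=
  ((isCompact_closedBall (0 : E) 1).image hi.continuous).isClosed

/-- **Continuity of the transported push** on `ℝ × (X ∖ {i 0})`: on the open set
`range i ∖ {i 0}` it is `i ∘ rₛ ∘ i⁻¹`, and on the open set `X ∖ i(B̄(0,1))` it is the identity.
[folklore] -/
theorem continuousOn_pushMap (hi : IsOpenEmbedding i) :
    ContinuousOn (fun p : ℝ × X => pushMap hi p.1 p.2) {p | p.2 ≠ i 0} := by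
  intro p hp
  have hp' : p.2 ≠ i 0 := hp
  by_cases hmem : p.2 ∈ i '' closedBall (0 : E) 1
  · -- near a point of `range i ∖ {i 0}`: the chart formula
    obtain ⟨u, -, hu⟩ := hmem
    have hu0 : u ≠ 0 := fun h => hp' (by rw [← hu, h])
    set Φ := hi.toOpenPartialHomeomorph i with hΦ
    have hO : IsOpen (range i \ {i 0}) := hi.isOpen_range.sdiff isClosed_singleton
    have hpO : p.2 ∈ range i \ {i 0} := ⟨⟨u, hu⟩, hp'⟩
    have hnhds : {q : ℝ × X | q.2 ∈ range i \ {i 0}} ∈ 𝓝 p :=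
      (hO.preimage continuous_snd).mem_nhds hpO
    have key : ContinuousAt (fun q : ℝ × X => i (radialPush q.1 (Φ.symm q.2))) p := by
      have h1 : ContinuousAt (fun q : ℝ × X => (q.1, Φ.symm q.2)) p := by
        refine continuousAt_fst.prodMk ((Φ.continuousOn_symm.continuousAt ?_).comp continuousAt_snd)
        rw [hi.toOpenPartialHomeomorph_target]
        exact hi.isOpen_range.mem_nhds ⟨u, hu⟩
      have h2 : ContinuousAt (fun q : ℝ × E => radialPush q.1 q.2) (p.1, Φ.symm p.2) := by
        refine continuousOn_radialPush.continuousAt (IsOpen.mem_nhds ?_ ?_)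
        · exact isOpen_compl_singleton.preimage continuous_snd
        · show Φ.symm p.2 ≠ 0
          rw [← hu, hΦ, hi.toOpenPartialHomeomorph_left_inv]; exact hu0
      exact hi.continuous.continuousAt.comp (ContinuousAt.comp_of_eq h2 h1 rfl)
    refine (key.congr ?_).continuousWithinAt
    filter_upwards [hnhds] with q hq
    obtain ⟨⟨v, hv⟩, -⟩ := hq
    show i (radialPush q.1 (Φ.symm q.2)) = pushMap hi q.1 q.2
    rw [← hv, pushMap_apply, hΦ, hi.toOpenPartialHomeomorph_left_inv]
  · -- near a point outside `i(B̄(0,1))`: the identity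
    have hO : IsOpen (i '' closedBall (0 : E) 1)ᶜ := (isClosed_image_closedBall hi).isOpen_compl
    have hnhds : {q : ℝ × X | q.2 ∈ (i '' closedBall (0 : E) 1)ᶜ} ∈ 𝓝 p :=
      (hO.preimage continuous_snd).mem_nhds hmem
    refine (continuousAt_snd.congr ?_).continuousWithinAt
    filter_upwards [hnhds] with q hq
    refine (pushMap_eq_self hi q.1 fun h => hq ?_).symm
    exact image_mono ball_subset_closedBall h

/-! ### The homotopy equivalence -/

variable (hi : IsOpenEmbedding i)

/-- The complement of the image of the open unit ball. [folklore] -/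
abbrev ComplBallT (i : E → X) : Type _ := {x : X // x ∉ i '' ball (0 : E) 1}

/-- The complement of the centre. [folklore] -/
abbrev ComplCenterT (i : E → X) : Type _ := {x : X // x ≠ i 0}

omit [NormedSpace ℝ E] [TopologicalSpace X] [T2Space X] [ProperSpace E] in
/-- A point outside the image of the open unit ball is not the centre. [folklore] -/
theorem ne_center_of_not_mem {x : X} (hx : x ∉ i '' ball (0 : E) 1) : x ≠ i 0 :=
  fun h => hx ⟨0, mem_ball_self one_pos, h.symm⟩

/-- **The inclusion** `X ∖ i(B̊(0,1)) ↪ X ∖ {i 0}`. [folklore] -/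
def incl : C(ComplBallT i, ComplCenterT i) :=
  ⟨fun x => ⟨x.1, ne_center_of_not_mem x.2⟩, by fun_prop⟩

/-- **The retraction** `X ∖ {i 0} → X ∖ i(B̊(0,1))`, the push at time `0`. [folklore] -/
def retr : C(ComplCenterT i, ComplBallT i) where
  toFun x := ⟨pushMap hi 0 x.1, pushMap_zero_not_mem hi x.2⟩
  continuous_toFun := by
    refine Continuous.subtype_mk ?_ _
    exact (continuousOn_pushMap hi).comp_continuous
      ((continuous_const : Continuous fun _ : ComplCenterT i => (0 : ℝ)).prodMk
        continuous_subtype_val) fun x => x.2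

/-- The retraction is a left inverse of the inclusion on the nose. [folklore] -/
theorem retr_comp_incl : (retr hi).comp (incl (i := i)) = ContinuousMap.id _ := by
  ext x
  exact pushMap_eq_self hi 0 x.2

/-- **The deformation**: the homotopy `s ↦ pushMap s` from `incl ∘ retr` to the identity of
`X ∖ {i 0}` (stationary on `X ∖ i(B̊(0,1))`). [folklore] -/
def deformation : ContinuousMap.Homotopy ((incl (i := i)).comp (retr hi)) (ContinuousMap.id _) where
  toFun p := ⟨pushMap hi p.1 p.2.1, pushMap_ne_center hi ⟨p.1.2.1, p.1.2.2⟩ p.2.2⟩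
  continuous_toFun := by
    refine Continuous.subtype_mk ?_ _
    exact (continuousOn_pushMap hi).comp_continuous
      ((continuous_subtype_val.comp continuous_fst).prodMk
        (continuous_subtype_val.comp continuous_snd)) fun p => p.2.2
  map_zero_left x := rfl
  map_one_left x := by
    ext
    exact pushMap_one hi x.1

/-- **The complement of an embedded open ball is homotopy equivalent to the complement of its
centre**, the equivalence being the inclusion `X ∖ i(B̊(0,1)) ↪ X ∖ {i 0}` with homotopy inverse
the radial push at time `0` (a strong deformation retraction). Hatcher, *Algebraic Topology*
(2002), Ch. 0, Exercise 2 (p. 18); Kervaire–Milnor 1963, §2 ("`M - Interior i(½Dⁿ)`" for `M ∖ {pt}`).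
[cite: HatcherAT2002, Ch. 0, Exercise 2 (p. 18)] -/
def homotopyEquiv : ComplBallT i ≃ₕ ComplCenterT i where
  toFun := incl
  invFun := retr hi
  left_inv := by rw [retr_comp_incl]
  right_inv := ⟨deformation hi⟩

/-- The forward map of `ComplBall.homotopyEquiv` is the inclusion. [folklore] -/
@[simp] theorem homotopyEquiv_apply (x : ComplBallT i) :
    (homotopyEquiv hi x : X) = x := rfl

include hi in
/-- **`X ∖ i(B̊(0,1))` is contractible iff `X ∖ {i 0}` is** (contractibility is a homotopy
invariant, Mathlib `ContinuousMap.HomotopyEquiv.contractibleSpace_iff`). [cite: HatcherAT2002, Ch. 0, Exercise 2 (p. 18)] -/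
theorem contractibleSpace_iff :
    ContractibleSpace (ComplBallT i) ↔ ContractibleSpace (ComplCenterT i) :=
  (homotopyEquiv hi).contractibleSpace_iff

end ComplBall

end Literature.AlgebraicTopology.Homotopy
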